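import Summits.BirchSwinnertonDyer.Rank1Residual.P2.RankOneSpecAtTwo
import Literature.NumberTheory.EllipticCurves.Monsky1990.MockHeegnerCongruentNumbers
import Literature.NumberTheory.EllipticCurves.CongruentNumberCurveRootNumberEven
import Literature.NumberTheory.EllipticCurves.CongruentNumberCurveLSeriesProofs
import Literature.NumberTheory.EllipticCurves.BSDSelmerCMPConverseRankOneProofs
import Literature.NumberTheory.EllipticCurves.GrossZagierRationalPoint
import HarnessLib

/-!
# Sub-lane «bsd-p2»: DOOR D-CN-5 — the RANK-ONE congruent-number families of Monsky 1990
# Cor 5.15: `BSD(E_N, 2) ⟺ ord₂(L′(E_N,1)/(Ω·Reg)) = ord₂ ∏c_ℓ(E_N) − 4`, a biconditional with NO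
# unknown `Ш` term and NO Gross–Zagier–Kolyvagin binder (p2-lead L2-14 / L2-16 / T-33)

HONEST FRAMING (sub-lane «bsd-p2», run/shared/lean/b2b/bsd-rank1-residual/p2/, verbatim in every
file): the target of record is the FULL Birch–Swinnerton-Dyer formula for EVERY analytic-rank `≤ 1`
`E/ℚ` at ALL primes INCLUDING `2`; the odd-prime class ledger is referee A's; the `2`-part is OPEN
(cells O1 = X5 ∖ CM and O12 = the CM corner) and under census by «bsd-p2». Census / instrument
output at `2` = EVIDENCE / conjecture items with held-out validation, NEVER a Literature fact;
certificates close PAIRS (one isogeny class, `p = 2`), never classes. This file asserts NO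
arithmetic fact. ONE PUBLISHED input as a binder: Monsky, Math. Z. 204 (1990) Cor 5.15 with Remark
(2) AS PRINTED by p2-lit-2 (`Monsky1990.cor515_rank_eq_one_and_card_selmerGroup_two`, p319203): for
`N` in the twelve families (`IsCor515Family N`; `N ≡ 5, 6, 7 (mod 8)`) `rank E_N(ℚ) = 1` and
`#Sel₂(E_N) = 8`, whence `Ш(E_N)[2^∞] = 0` (lit-2's `primaryComponent_sha_two_eq_bot_of_cor515`).
Everything else is a tree THEOREM: `L(E_N, 1) = 0` for square-free `N ≡ 5, 6, 7 (mod 8)` (root number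
`−1`, Hecke's functional equation PROVED in `CongruentNumberCurveRootNumber{,Even}`), the entire
continuation of `L(E_N, s)` (CM, PROVED: `hasEntireLFunction_congruentNumberCurve_holds`), hence
`L′(E_N,1) ≠ 0 ⇒ ord_{s=1} L(E_N,s) = 1`. CONCLUSION (door D-CN-5): with `#E_N(ℚ)_tor = 4` (binder
`ht` until lit-2's torsion theorem lands, L2-15) and the rank-one datum `L′(E_N,1) = x·Ω·Reg`,
`x ∈ ℚ`, `x ≠ 0`: `ord_{s=1} L(E_N, s) = 1` AND `BSD(E_N, 2) ⟺ ord₂ x = ord₂ ∏c_ℓ(E_N) − 4` — no GZK,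
no Kolyvagin, no finiteness of the odd part of `Ш` (Miller's `BSD(E,2)` reads `Ш[2^∞]` only). The
CELL: `E_N` is CM (`j = 1728`), `2` ramified, `r_an = 1`, additive at `2` — status `openO12`
(`CornerFSharp`): these pairs sit in an OPEN cell; the door makes the pair's `BSD₂` ONE exact
valuation of the rank-one engine's `x` (`P2/HeegnerIndexAtTwo.lean` computes `x` from a Heegner
point — here over `ℚ(i√(NN*))`-free data: any exact `L′/(ΩR)` will do). Per-pair statements; they
close no class. Nothing booked; no mark moved. Unit `b2b-bsdres-p2-typer` GEN 3 (p2-lead L2-14 /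
L2-16 / T-33); NEW file, sibling of `P2/CongruentNumberPairsAtTwo.lean`.

References: Monsky, Math. Z. 204 (1990) 45–67, Cor. 5.15, Remark (2) [Monsky1990MockHeegner]; Koblitz,
*Introduction to Elliptic Curves and Modular Forms*, Ch. II §5 (root number of `E_n`) [KoblitzECMF1993];
Miller 2011 Def 1.1 [Miller2011LMS]; HOME/p2/LEAD-OKS.md L2-14, L2-16, T-33.
-/

noncomputable section

open scoped Classical

open WeierstrassCurve Literature.NumberTheory.EllipticCurves
  Literature.NumberTheory.EllipticCurves.Rank1Residual
  Literature.NumberTheory.EllipticCurves.Rank1Residual.Typed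
  Literature.NumberTheory.EllipticCurves.Monsky1990

set_option autoImplicit false

namespace Summit.BirchSwinnertonDyer.Rank1Residual.P2

/-- **`ord_{s=1} L(E_N, s) = 1` on Monsky's families from `L′(E_N,1) ≠ 0` ALONE** (no Monsky fact
needed here): for square-free `N ≡ 5, 6, 7 (mod 8)` the root number is `−1`, so `L(E_N,1) = 0` (tree
theorem `entireLFunction_congruentNumberCurve_one_eq_zero_of_mod_eight`), `L(E_N,s)` is entire (CM,
`hasEntireLFunction_congruentNumberCurve_holds`), and a zero with non-vanishing derivative is simple.
[cite: KoblitzECMF1993, Ch. II §5, Theorem (p. 84)] -/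
theorem analyticRank_congruentNumberCurve_eq_one_of_deriv_ne_zero {N : ℕ} (hsq : Squarefree N)
    (h8 : N % 8 = 5 ∨ N % 8 = 6 ∨ N % 8 = 7)
    (hder : deriv (congruentNumberCurve N).entireLFunction 1 ≠ 0) :
    haveI := isElliptic_congruentNumberCurve (Squarefree.ne_zero hsq)
    (congruentNumberCurve N).analyticRank = 1 := by
  haveI := isElliptic_congruentNumberCurve (Squarefree.ne_zero hsq)
  exact analyticRank_eq_one_of_entireLFunction_one_eq_zero_of_deriv_ne_zero _
    (hasEntireLFunction_congruentNumberCurve_holds hsq)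
    (entireLFunction_congruentNumberCurve_one_eq_zero_of_mod_eight hsq h8) hder

/-- **DOOR D-CN-5.** `N` in Monsky's Cor 5.15 families (`IsCor515Family N`), Monsky's fact (`h515`:
rank `1`, `#Sel₂ = 8`, hence `Ш(E_N)[2^∞] = 0`), `#E_N(ℚ)_tor = 4` (`ht`), and the rank-one datum
`L′(E_N,1) = x·Ω(E_N)·Reg(E_N)` with `x ∈ ℚ`, `x ≠ 0` (read on the globally minimal model
`congruentNumberCurve N`). THEN `ord_{s=1} L(E_N,s) = 1` and
`BSD(E_N, 2) ⟺ ord₂ x = ord₂ ∏c_ℓ(E_N) − 4` (`#Ш_an = x·16/∏c_ℓ` must be a `2`-adic unit, `Ш[2^∞]`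
being trivial). No GZK / Kolyvagin / modularity binder: rank from Monsky, analytic rank from the root
number and `x ≠ 0`, `Ш[2^∞]` from the descent count. A per-pair biconditional; it closes no class
(cell `openO12`). [cite: Monsky1990MockHeegner, Cor. 5.15 (p. 66) and Remark (2) (p. 67)]
[cite: Miller2011LMS, Def. 1.1 (arXiv:1010.2431 p. 3)] -/
theorem bsdp_two_congruentNumberCurve_iff_of_cor515
    (h515 : cor515_rank_eq_one_and_card_selmerGroup_two) {N : ℕ} (hN : IsCor515Family N)
    (ht : (congruentNumberCurve N).torsionOrder = 4) {x : ℚ} (hx0 : x ≠ 0)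
    (hx : deriv (congruentNumberCurve N).entireLFunction 1 =
      (x : ℂ) * ((congruentNumberCurve N).realPeriodRat : ℂ) *
        ((congruentNumberCurve N).regulator : ℂ)) :
    haveI := isElliptic_congruentNumberCurve hN.ne_zero
    (congruentNumberCurve N).analyticRank = 1 ∧
      (BSDp (congruentNumberCurve N) 2 ↔
        padicValRat 2 x = (padicValNat 2 (congruentNumberCurve N).tamagawaProduct : ℤ) - 4) := by
  have hn : N ≠ 0 := hN.ne_zero
  have hsq : Squarefree N := hN.squarefree
  haveI := isElliptic_congruentNumberCurve hn
  haveI : Fact (2 : ℕ).Prime := ⟨Nat.prime_two⟩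
  -- Monsky: rank 1, `Ш[2^∞] = 0`
  have hrank : (congruentNumberCurve N).mordellWeilRank = 1 := (h515 N hN).1
  have hbot : AddCommGroup.primaryComponent (congruentNumberCurve N).sha 2 = ⊥ :=
    primaryComponent_sha_two_eq_bot_of_cor515 h515 hN
  -- root number + `x ≠ 0`: `r_an = 1`
  have hΩ : ((congruentNumberCurve N).realPeriodRat : ℂ) ≠ 0 := by
    exact_mod_cast (congruentNumberCurve N).realPeriodRat_pos_holds.ne'
  have hR : ((congruentNumberCurve N).regulator : ℂ) ≠ 0 := by
    exact_mod_cast (congruentNumberCurve N).regulator_pos'.ne'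
  have hder : deriv (congruentNumberCurve N).entireLFunction 1 ≠ 0 := by
    rw [hx]
    exact mul_ne_zero (mul_ne_zero (by exact_mod_cast hx0) hΩ) hR
  have hr1 : (congruentNumberCurve N).analyticRank = 1 :=
    analyticRank_congruentNumberCurve_eq_one_of_deriv_ne_zero hsq hN.mod_eight hder
  refine ⟨hr1, ?_⟩
  -- `#Ш_an = x · 16 / ∏c_ℓ`
  have hL : (congruentNumberCurve N).leadingLCoeff =
      (x : ℂ) * ((congruentNumberCurve N).realPeriodRat : ℂ) *
        ((congruentNumberCurve N).regulator : ℂ) := by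
    rw [(leadingLCoeff_eq_deriv_of_analyticRank_eq_one hr1).1, hx]
  have hsha := shaAn_eq_of_leadingLCoeff (congruentNumberCurve N) hL
  have hcard : Nat.card (AddCommGroup.primaryComponent (congruentNumberCurve N).sha 2) = 1 := by
    rw [hbot]; exact AddSubgroup.card_bot
  have hc : ((congruentNumberCurve N).tamagawaProduct : ℚ) ≠ 0 := by
    exact_mod_cast (congruentNumberCurve N).tamagawaProduct_pos_holds.ne'
  have h16 : padicValRat 2 (((4 : ℕ) : ℚ) ^ 2) = 4 := by
    rw [show (((4 : ℕ) : ℚ)) ^ 2 = ((2 ^ 4 : ℕ) : ℚ) by norm_num, padicValRat.of_nat,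
      padicValNat.prime_pow]
    norm_num
  have hval : padicValRat 2 (x * ((congruentNumberCurve N).torsionOrder : ℚ) ^ 2 /
      ((congruentNumberCurve N).tamagawaProduct : ℚ)) =
      padicValRat 2 x + 4 - padicValNat 2 (congruentNumberCurve N).tamagawaProduct := by
    rw [ht, padicValRat.div (mul_ne_zero hx0 (by norm_num)) hc, padicValRat.mul hx0 (by norm_num),
      padicValRat.of_nat, h16]
  -- Miller's `BSD(E,2)` unfolded
  rw [bsdp_iff]
  constructor
  · rintro ⟨-, -, q, hq, hv⟩
    have hqq : q = x * ((congruentNumberCurve N).torsionOrder : ℚ) ^ 2 /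
        ((congruentNumberCurve N).tamagawaProduct : ℚ) :=
      Rat.cast_injective (α := ℂ) (hq.symm.trans hsha)
    rw [hqq, hval, hcard] at hv
    simp only [padicValNat_one_right, Nat.cast_zero] at hv
    linarith
  · intro hv
    refine ⟨by rw [hrank, hr1], by rw [hbot]; infer_instance, _, hsha, ?_⟩
    rw [hval, hcard]
    simp only [padicValNat_one_right, Nat.cast_zero]
    linarith

end Summit.BirchSwinnertonDyer.Rank1Residual.P2

end
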